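import Mathlib
import Summits.Ventures.HodgeRepro2.T5DoubleCosetDecomposition
import Summits.Ventures.HodgeRepro2.T5BallQuotientDecomposition

/-!
# T5LevelChange — change of level `K′ ≤ K` on the double-coset spaces (group-theoretic half)

Kernel annex of the blind cell `pub-hodge-repro2`, seat p2, Tier-5 sub-step N1
(route/T5-ID-p2.md, G-ID-4 «level bookkeeping») and T4-B5 (the common level `K = K_0 ∩ ⋂ K_i`).

For finite levels `K′ ≤ K ≤ B` (and a fixed archimedean level `K_∞ ≤ A`) the level-change map

  `levelMap : H \ (A × B) / (K_∞ × K′) → H \ (A × B) / (K_∞ × K)`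

is well defined and surjective, commutes with the finite parts, the arithmetic groups shrink with
the level (`Γ_g(K′) ≤ Γ_g(K)`), and every fibre of `levelMap` is the image of `K / K′`, hence FINITE
when `K′` has finite index in `K` — «`S_{K′} → S_K` is a finite surjective map of sets of complex
points».  The degree of the map, the integral descent and the analytic structure stay prose
(`T5IntegralBookkeeping` handles the integrals abstractly).
-/

namespace Summit.Ventures.HodgeRepro2.T5LevelChange

open Summit.Ventures.HodgeRepro2.T5DoubleCosetDecomposition
open Summit.Ventures.HodgeRepro2.T5BallQuotientDecomposition

universe u v

variable {A : Type u} {B : Type v} [Group A] [Group B]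

/-- `Γ_g` shrinks with the level: `K′ ≤ K ⇒ Γ_g(K′) ≤ Γ_g(K)`. -/
theorem gammaGroup_mono (H : Subgroup (A × B)) {K' K : Subgroup B} (hK : K' ≤ K) (g : B) :
    gammaGroup H K' g ≤ gammaGroup H K g := by
  rintro a ⟨h, hH, rfl, k, hk, hk'⟩
  exact ⟨h, hH, rfl, k, hK hk, hk'⟩

/-- `K_∞ × K′ ≤ K_∞ × K` for `K′ ≤ K`. -/
theorem levelProd_mono (Kinf : Subgroup A) {K' K : Subgroup B} (hK : K' ≤ K) :
    levelProd Kinf K' ≤ levelProd Kinf K := by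
  intro p hp
  rw [mem_levelProd] at hp ⊢
  exact ⟨hp.1, hK hp.2⟩

/-- The level-change map on the finite double-coset spaces, `H_B b K′ ↦ H_B b K`. -/
def finiteLevelMap (H : Subgroup (A × B)) {K' K : Subgroup B} (hK : K' ≤ K)
    (q : FiniteQuotient H K') : FiniteQuotient H K :=
  Quotient.liftOn' q (fun b => DoubleCoset.mk (imageSnd H) K b) (fun b b' hbb' => by
    obtain ⟨h, hh, k, hk, rfl⟩ := DoubleCoset.rel_iff.1 hbb'
    exact (DoubleCoset.eq _ _ _ _).2 ⟨h, hh, k, hK hk, rfl⟩)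

/-- `finiteLevelMap` on a representative. -/
@[simp]
theorem finiteLevelMap_mk (H : Subgroup (A × B)) {K' K : Subgroup B} (hK : K' ≤ K) (b : B) :
    finiteLevelMap H hK (DoubleCoset.mk (imageSnd H) K' b) = DoubleCoset.mk (imageSnd H) K b :=
  rfl

/-- `finiteLevelMap` is surjective. -/
theorem finiteLevelMap_surjective (H : Subgroup (A × B)) {K' K : Subgroup B} (hK : K' ≤ K) :
    Function.Surjective (finiteLevelMap H hK) := by
  intro q
  induction q using Quotient.inductionOn' with
  | h b => exact ⟨DoubleCoset.mk (imageSnd H) K' b, rfl⟩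

/-- The level-change map `H (a, b) (K_∞ × K′) ↦ H (a, b) (K_∞ × K)`. -/
def levelMap (H : Subgroup (A × B)) (Kinf : Subgroup A) {K' K : Subgroup B} (hK : K' ≤ K)
    (t : FullQuotientDC H Kinf K') : FullQuotientDC H Kinf K :=
  Quotient.liftOn' t (fun p => DoubleCoset.mk H (levelProd Kinf K) p) (fun p p' hpp' => by
    obtain ⟨h, hh, k, hk, rfl⟩ := DoubleCoset.rel_iff.1 hpp'
    exact (DoubleCoset.eq _ _ _ _).2 ⟨h, hh, k, levelProd_mono Kinf hK hk, rfl⟩)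

/-- `levelMap` on a representative. -/
@[simp]
theorem levelMap_mk (H : Subgroup (A × B)) (Kinf : Subgroup A) {K' K : Subgroup B} (hK : K' ≤ K)
    (p : A × B) :
    levelMap H Kinf hK (DoubleCoset.mk H (levelProd Kinf K') p) =
      DoubleCoset.mk H (levelProd Kinf K) p :=
  rfl

/-- `levelMap` is surjective: «`S_{K′} → S_K` is onto». -/
theorem levelMap_surjective (H : Subgroup (A × B)) (Kinf : Subgroup A) {K' K : Subgroup B}
    (hK : K' ≤ K) : Function.Surjective (levelMap H Kinf hK) := by
  intro t
  induction t using Quotient.inductionOn' with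
  | h p => exact ⟨DoubleCoset.mk H (levelProd Kinf K') p, rfl⟩

/-- The level-change map commutes with the finite parts. -/
theorem finitePartDC_levelMap (H : Subgroup (A × B)) (Kinf : Subgroup A) {K' K : Subgroup B}
    (hK : K' ≤ K) (t : FullQuotientDC H Kinf K') :
    finitePartDC (levelMap H Kinf hK t) = finiteLevelMap H hK (finitePartDC t) := by
  induction t using Quotient.inductionOn' with
  | h p => rfl

/-- Transitivity: changing the level in two steps is changing it in one. -/
theorem levelMap_levelMap (H : Subgroup (A × B)) (Kinf : Subgroup A) {K'' K' K : Subgroup B}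
    (hK' : K'' ≤ K') (hK : K' ≤ K) (t : FullQuotientDC H Kinf K'') :
    levelMap H Kinf hK (levelMap H Kinf hK' t) = levelMap H Kinf (hK'.trans hK) t := by
  induction t using Quotient.inductionOn' with
  | h p => rfl

/-- The fibre of `levelMap` over `H (a, b) (K_∞ × K)` is the set of the
`H (a, b k) (K_∞ × K′)`, `k ∈ K`. -/
theorem levelMap_fiber_eq_range (H : Subgroup (A × B)) (Kinf : Subgroup A) {K' K : Subgroup B}
    (hK : K' ≤ K) (a : A) (b : B) :
    levelMap H Kinf hK ⁻¹' {DoubleCoset.mk H (levelProd Kinf K) (a, b)} =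
      Set.range (fun k : K => DoubleCoset.mk H (levelProd Kinf K') (a, b * k)) := by
  ext t
  induction t using Quotient.inductionOn' with
  | h p =>
    obtain ⟨a', b'⟩ := p
    simp only [Set.mem_preimage, Set.mem_singleton_iff, Set.mem_range]
    constructor
    · intro ht
      have ht' : DoubleCoset.mk H (levelProd Kinf K) (a', b') =
          DoubleCoset.mk H (levelProd Kinf K) (a, b) := ht
      obtain ⟨h, hH, k, hk, hprod⟩ := (DoubleCoset.eq _ _ _ _).1 ht'
      obtain ⟨hk1, hk2⟩ := mem_levelProd.1 hk
      have ha : a = h.1 * a' * k.1 := by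
        have := congrArg Prod.fst hprod
        simpa only [Prod.fst_mul] using this
      have hb : b = h.2 * b' * k.2 := by
        have := congrArg Prod.snd hprod
        simpa only [Prod.snd_mul] using this
      refine ⟨⟨k.2⁻¹, K.inv_mem hk2⟩, ?_⟩
      show DoubleCoset.mk H (levelProd Kinf K') (a, b * k.2⁻¹) =
        DoubleCoset.mk H (levelProd Kinf K') (a', b')
      rw [DoubleCoset.eq]
      refine ⟨h⁻¹, H.inv_mem hH, (k.1⁻¹, 1), mem_levelProd.2 ⟨Kinf.inv_mem hk1, K'.one_mem⟩, ?_⟩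
      ext
      · simp only [Prod.fst_mul, Prod.fst_inv]
        rw [ha]
        group
      · simp only [Prod.snd_mul, Prod.snd_inv]
        rw [hb]
        group
    · rintro ⟨⟨k, hk⟩, hk'⟩
      have hk'' : DoubleCoset.mk H (levelProd Kinf K') (a, b * k) =
          DoubleCoset.mk H (levelProd Kinf K') (a', b') := hk'
      obtain ⟨h, hH, k', hk', hprod⟩ := (DoubleCoset.eq _ _ _ _).1 hk''
      obtain ⟨hk'1, hk'2⟩ := mem_levelProd.1 hk'
      show DoubleCoset.mk H (levelProd Kinf K) (a', b') = DoubleCoset.mk H (levelProd Kinf K) (a, b)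
      symm
      rw [DoubleCoset.eq]
      refine ⟨h, hH, (1, k) * k', mem_levelProd.2 ⟨?_, ?_⟩, ?_⟩
      · simpa only [Prod.fst_mul, one_mul] using hk'1
      · simp only [Prod.snd_mul]
        exact K.mul_mem hk (hK hk'2)
      · rw [hprod]
        ext
        · simp only [Prod.fst_mul, one_mul]
        · simp only [Prod.snd_mul]
          group

/-- The fibre map factors through `K / K′`: the parametrisation `k ↦ H (a, b k) (K_∞ × K′)` of
the fibre is constant on the left cosets `k K′`. -/
def fiberMap (H : Subgroup (A × B)) (Kinf : Subgroup A) (K' K : Subgroup B)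
    (a : A) (b : B) (x : K ⧸ K'.subgroupOf K) : FullQuotientDC H Kinf K' :=
  Quotient.liftOn' x (fun k : K => DoubleCoset.mk H (levelProd Kinf K') (a, b * k)) (by
    intro k₁ k₂ hk
    have hk' : (k₁ : B)⁻¹ * k₂ ∈ K' := by
      rw [QuotientGroup.leftRel_apply, Subgroup.mem_subgroupOf] at hk
      exact hk
    rw [DoubleCoset.eq]
    refine ⟨1, H.one_mem, (1, (k₁ : B)⁻¹ * k₂), mem_levelProd.2 ⟨Kinf.one_mem, hk'⟩, ?_⟩
    ext
    · simp
    · simp only [Prod.snd_mul, one_mul]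
      group)

/-- `fiberMap` on a representative. -/
@[simp]
theorem fiberMap_mk (H : Subgroup (A × B)) (Kinf : Subgroup A) (K' K : Subgroup B)
    (a : A) (b : B) (k : K) :
    fiberMap H Kinf K' K a b (QuotientGroup.mk k) =
      DoubleCoset.mk H (levelProd Kinf K') (a, b * k) :=
  rfl

/-- The range of the fibre parametrisation is the range of the induced map on `K / K′`. -/
theorem range_fiberMap (H : Subgroup (A × B)) (Kinf : Subgroup A) (K' K : Subgroup B)
    (a : A) (b : B) :
    Set.range (fiberMap H Kinf K' K a b) =
      Set.range (fun k : K => DoubleCoset.mk H (levelProd Kinf K') (a, b * k)) := by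
  have : (fun k : K => DoubleCoset.mk H (levelProd Kinf K') (a, b * k)) =
      fiberMap H Kinf K' K a b ∘ QuotientGroup.mk := rfl
  rw [this, (QuotientGroup.mk_surjective).range_comp]

/-- FINITE FIBRES: if `K′` has finite index in `K` then every fibre of `levelMap` is finite —
«`S_{K′} → S_K` is a finite map of sets». -/
theorem levelMap_fiber_finite (H : Subgroup (A × B)) (Kinf : Subgroup A) {K' K : Subgroup B}
    (hK : K' ≤ K) [Finite (K ⧸ K'.subgroupOf K)] (t : FullQuotientDC H Kinf K) :
    (levelMap H Kinf hK ⁻¹' {t}).Finite := by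
  induction t using Quotient.inductionOn' with
  | h p =>
    obtain ⟨a, b⟩ := p
    rw [show (Quotient.mk'' (a, b) : FullQuotientDC H Kinf K) =
      DoubleCoset.mk H (levelProd Kinf K) (a, b) from rfl]
    rw [levelMap_fiber_eq_range, ← range_fiberMap H Kinf K' K a b]
    exact Set.finite_range _

/-- Sanity check: changing the level to itself is the identity. -/
theorem levelMap_refl (H : Subgroup (A × B)) (Kinf : Subgroup A) (K : Subgroup B)
    (t : FullQuotientDC H Kinf K) : levelMap H Kinf (le_refl K) t = t := by
  induction t using Quotient.inductionOn' with
  | h p => rfl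

end Summit.Ventures.HodgeRepro2.T5LevelChange
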